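import Summits.QuantumFields.YangMills.Theorems.UnitScaleTiltProp7TwistedSliceGaugeOntoSU2Letters
import HarnessLib

/-!
# Route `UnitScaleTilt`, crux K1 child «MinimiserStabilityRegPr» (stmt-QuantumFields-19200), skeleton v10, stub `stub_existenceMinimalOrbit` (EX), route (α) — **(R-T5): THE (P1) PAIR
# OF `hSplitD` IS REAL — from ANY complex pair `(β, N)` with `D(log U̿^{twS})(A₁)β = 0` and `ξ = g(ad(−A₁))β + (N(b₋) − U′(b)N(b₊)U′(b)⁻¹)` at an `𝔰𝔲(2)` chart point `A₁` and an
# `𝔰𝔲(2)`-valued `ξ`, an `𝔰𝔲(2)`-VALUED `β′` with `D(log U̿^{twS})(A₁)β′ = 0` and a HERMITIAN TRACELESS `N′` with `ξ = g(ad(−A₁))β′ + (iN′(b₋) − U′(b)·iN′(b₊)·U′(b)⋆)`** — the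
# `∃ δ … ∃ N (Herm., tr 0)` currency of the displayed row `hSplitD` of ✓`Prop7FibreELOfCritSplitD.fibreEL_of_crit_splitD` on the (P1) side (★w5-20520 g6's word «w4: (R-T5) θ — GO»,
# 2026-08-28 16:10:57Z; consumes the conclusion of his T5 (B) ★★★`Prop7TwistedSliceGaugeOntoTower.exists_slice_tangent_add_gaugeDir_of_QSym_eq_zero_of_tower` as the hypotheses
# `hβ`, `hsplit`, so it is independent of the tower-closeness currency).

Cell `ym3-torus`, width seat `ym-ust-20520-w4` (gen 6; the seat's reality lineage: ✓`Prop7ChartRealityTwS` (g3), ✓`Prop7QTwSReality`∕`Prop7H46Reality…` (g4), ✓`Prop7FrakGReality…`∕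
✓`Prop7GaugeSliceDecomposition(Split)` (g5)).  THEOREMS ONLY (0 `def`, 0 `sorry`).  `--supports stmt-QuantumFields-19200 --as helper`, count-neutral.  YM₃ on T³ is a ladder rung (R3),
not the Clay problem; nothing here claims the stub, the crux, d = 4 or the mass gap.

THE ARGUMENT (θ-averaging with the trace handled separately, as ★w5 asked: «mind the TRACE part … `logChartTwS` is NOT blind to central directions»).  Write `D := fderiv ℂ (logChartTwS U₀) A₁`,
`M_b := g(ad(−A₁(b)))`, `G N(b) := N(b₋) − U′(b)N(b₊)U′(b)⋆`.  TWO real-sector facts about `D` and nothing else of the chart are used: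
(S1) `D` maps `𝔰𝔲(2)`-valued directions to `𝔰𝔲(2)`-valued coarse fields — the chart is `𝔰𝔲(2)`-valued on the real ball `‖A(b)‖ ≤ e·η` (✓`Prop7ChartRealityTwS.logChartTwS_skewHermitian_of_ball`
+ ✓`dbarTwS_mem_specialUnitaryUnits_of_skewHermitian`), `A₁ + tα` stays in it, and the slopes of an `𝔰𝔲(2)`-valued curve stay in the closed real subspace (✓`fderiv_apply_mem_of_mapsTo_of_ball`,
re-based at `A₁`); (S2) `D` maps CENTRAL directions `s·1` to central coarse fields — ★★`Prop7SymAvgTwSym.logChartTwS_add_central` AT `A := A₁` (`log U̿^{twS}(A₁ + (iz)·1) = log U̿^{twS}(A₁) +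
(iLᵏQ_k z)·1`, ★w5-20520 g5) and the same closed-subspace trick; its displayed `1∕8`-rows `hWl`∕`hT` (loops ∕ twisted stairs of the perturbed covariant tower of `U′ = e^{A₁}U₀`, `j < k`,
gauge-invariant) are DISPLAYED here too — supplier: the tower-closeness letter from `RegPr` (the same open item as T5's `hH`).  Then, pointwise: `tr ξ = 0` forces the scalar parts of
`(β, N)` to cancel in the split (`tr ∘ M = tr`, `M(s·1) = s·1`, `tr(U X U⋆) = tr X`), so the traceless parts `(β_tl, N_tl)` split `ξ`; `D β = D β♮ + i·D b + D(s·1)` with `β♮`, `b` the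
`𝔰𝔲(2)`-components of `β_tl` lands in `𝔰𝔲(2) ⊕ i𝔰𝔲(2) ⊕ ℂ·1 = M₂(ℂ)` coarse-bondwise, so `D β = 0 ⇒ D β♮ = 0`; and `ξ = ½(ξ − ξ⋆)` with `(M x)⋆ = M(x⋆)` (`A₁` skew), `(G N)⋆ = G(N⋆)` (`U′`
unitary) gives `ξ = M β♮ + G N♮`, `N♮ := ½(N_tl − N_tl⋆)`, `N′ := −i·N♮` Hermitian traceless.

THE PRINT.  [Balaban1985Variational] (51) p. 286 («for A′ with values in 𝔤 the configuration D(A′) has values in 𝔤»), (82)–(83) p. 290 (the real tangent space and the gauge directions);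
[Balaban1985BackgroundPropagators] (3.13)–(3.15) p. 393 (the averaging function is `𝔤`-valued; its behaviour on gauge∕central directions), (3.19) p. 393; [Balaban1985Averaging] (32)–(34)
pp. 22–23 (`g(ad)`), (125)–(127) p. 36 (the flat multi-level average in the centre).

WHAT IS PROVED (sorry-free, no definition; ns `…Theorems.Prop7TwistedSliceGaugeOntoSU2`; the letters (S1) ★★`fderiv_logChartTwS_su2`, (S2) ★★`fderiv_logChartTwS_central`, (θ-M)
★`star_gSer_ad_apply`∕`trace_gSer_ad_apply_eq`∕`gSer_ad_apply_smul_one` and the splitting ★`eq_zero_of_su2_add_I_smul_su2_add_smul_one` are the sibling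
`UnitScaleTiltProp7TwistedSliceGaugeOntoSU2Letters`):
`coe_bgUnits_apply` (`↑(U♭ b) = ↑(U b)`, `↑(U♭ b)⁻¹ = (↑(U b))⋆`), ★★★`exists_su2_slice_tangent_add_gaugeDir_of_complex` — the title statement.
HONEST SCOPE.  Linear algebra and two closed-subspace arguments over landed theorems; the `1∕8` tower rows at `A₁` are hypotheses (gauge-invariant smallness of the `U′`-tower, not
proved here); (P2) (Landau transversality at the chart point), the complex (P1) solver itself (T5) and the tower-closeness letter are NOT here; nothing of `hSplitD`, EX, the crux, N06(d = 3)
or the gap is proved.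

References: T. Bałaban, CMP **102** (1985) 277–309 [Balaban1985Variational] ((51) p.286, (82)–(83) p.290); CMP **99** (1985) 389–434 [Balaban1985BackgroundPropagators] ((3.13)–(3.15),
(3.19) p.393); CMP **98** (1985) 17–51 [Balaban1985Averaging] ((32)–(34) pp.22–23, (125)–(127) p.36).
-/

set_option autoImplicit false

noncomputable section

open scoped BigOperators Matrix Matrix.Norms.L2Operator Topology Nat
open Filter Metric Set NormedSpace

namespace Summit.QuantumFields.YangMills.Theorems.Prop7TwistedSliceGaugeOntoSU2

open Literature.Analysis.Calculus.ExpDifferential (ad ad_apply gSer gSer_ad_apply summable_gSer_term')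
open Literature.MathematicalPhysics.QuantumFieldTheory.Balaban1983to89
open Literature.MathematicalPhysics.QuantumFieldTheory.Balaban1983to89.T3ContinuumYM3Torus
open T4Continuum BlockAveraging ExpMeanLog LatticeFieldCalculus
open T3LevelShift (bondShift)
open T3PrintedRegularOrbits (sites_eq)
open T3PrintedRegularMinimiser (RegPr)
open T3SectALandauChart (eta eta_pos bgUnits)
open B7Prop1Explicit (expUnit)
open B7Prop2SpecialUnitary (specialUnitaryUnits)
open Summit.QuantumFields.YangMills.Theorems.Prop8Chart (loopHolU emlIterU)
open Summit.QuantumFields.YangMills.Theorems.Prop7SymAvgTwSym (tstairU dbarCovIterU dbarTwS logChartTwS logChartTwS_add_central norm_dbarTwS_sub_one_le_eighth_of_regPr)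
open Summit.QuantumFields.YangMills.Theorems.Prop7CmapTwSymInputs (analyticOnNhd_logChartTwS)
open Summit.QuantumFields.YangMills.Theorems.Prop7ChartRealityTwS (fderiv_apply_mem_of_mapsTo_of_ball logChartTwS_skewHermitian_of_ball dbarTwS_mem_specialUnitaryUnits_of_skewHermitian)

/-! ## §3 The θ-average: an `𝔰𝔲(2)` pair from any complex (P1) pair -/

section Main

variable (F : T3Family) {n K : ℕ} (h : n ≤ K)

/-- `↑(U♭ b) = ↑(U b)` and `↑(U♭ b)⁻¹ = (↑(U b))⋆` for an `SU(2)` configuration read in units (`bgUnits`). [cite: Balaban1985Averaging, (19) p.21] -/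
theorem coe_bgUnits_apply (U : GaugeField (F.P K) 0 (Matrix.specialUnitaryGroup (Fin 2) ℂ)) (b : PBond (F.P K) 0) :
    ((bgUnits F K U b : (Matrix (Fin 2) (Fin 2) ℂ)ˣ) : Matrix (Fin 2) (Fin 2) ℂ) = ((U b : Matrix.specialUnitaryGroup (Fin 2) ℂ) : Matrix (Fin 2) (Fin 2) ℂ) ∧
    (((bgUnits F K U b)⁻¹ : (Matrix (Fin 2) (Fin 2) ℂ)ˣ) : Matrix (Fin 2) (Fin 2) ℂ) = star ((U b : Matrix.specialUnitaryGroup (Fin 2) ℂ) : Matrix (Fin 2) (Fin 2) ℂ) := by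
  have h1 : ((bgUnits F K U b : (Matrix (Fin 2) (Fin 2) ℂ)ˣ) : Matrix (Fin 2) (Fin 2) ℂ) = ((U b : Matrix.specialUnitaryGroup (Fin 2) ℂ) : Matrix (Fin 2) (Fin 2) ℂ) := rfl
  refine ⟨h1, Units.inv_eq_of_mul_eq_one_left ?_⟩
  rw [h1]
  exact Matrix.mem_unitaryGroup_iff'.1 (U b).2.1

/-- ★★★ **THE (P1) PAIR OF `hSplitD` IS REAL.**  At `U₀ ∈ 𝔘_k(ε₀)` (`10⁹L²e ≤ 1`, `10¹²L³ε₀ ≤ 1`), an `𝔰𝔲(2)` chart point `A₁` (`‖A₁‖ < e·η`) with the displayed `1∕8` tower rows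
`hWl`∕`hT`, any `SU(2)` configuration `U′` (only its unitarity is used), an `𝔰𝔲(2)`-valued `ξ`, and ANY complex pair `(β, N)` with `D(logChartTwS U₀)(A₁)β = 0` and
`ξ(b) = g(ad(−A₁ b))(β b) + (N b₋ − U′♭(b)·N b₊·U′♭(b)⁻¹)` (the conclusion of ★★★`Prop7TwistedSliceGaugeOntoTower.exists_slice_tangent_add_gaugeDir_of_QSym_eq_zero_of_tower`):
there are an `𝔰𝔲(2)`-VALUED `β′` with `D(logChartTwS U₀)(A₁)β′ = 0` and a HERMITIAN TRACELESS `N′` with `ξ(b) = g(ad(−A₁ b))(β′ b) + (i·N′(b₋) − U′(b)·(i·N′(b₊))·U′(b)⋆)` — the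
`hSplitD` currency on the (P1) side.  `β′ :=` the `𝔰𝔲(2)`-component of `β`, `N′ := −i·(skew part of the traceless part of N)`; (S1)+(S2) for the first row, (θ-M)+unitarity for the second.
[cite: Balaban1985Variational, (51) p.286, (82)-(83) p.290; Balaban1985BackgroundPropagators, (3.13)-(3.15) p.393, (3.19) p.393; Balaban1985Averaging, (32)-(34) pp.22-23] -/
theorem exists_su2_slice_tangent_add_gaugeDir_of_complex {ε₀ e : ℝ} (hε₀ : 0 < ε₀) (he : 0 < e) (hWe : 10 ^ 9 * (F.L : ℝ) ^ 2 * e ≤ 1) (hWε : 10 ^ 12 * (F.L : ℝ) ^ 3 * ε₀ ≤ 1)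
    (U₀ : GaugeField (F.P K) 0 (Matrix.specialUnitaryGroup (Fin 2) ℂ)) (hreg : RegPr F n K ε₀ U₀)
    {A₁ : PBond (F.P K) 0 → Matrix (Fin 2) (Fin 2) ℂ} (hA₁ : ‖A₁‖ < e * eta F n K) (hA₁R : ∀ b, star (A₁ b) = -A₁ b ∧ (A₁ b).trace = 0)
    (hWl : ∀ j, j < K - n → ∀ (c : PBond (F.P K) (j + 1)) (i : Idx (F.P K)),
      ‖((loopHolU (dbarCovIterU j (bgUnits F K U₀) (fun b => expUnit (A₁ b) * bgUnits F K U₀ b)) c i : (Matrix (Fin 2) (Fin 2) ℂ)ˣ) : Matrix (Fin 2) (Fin 2) ℂ) - 1‖ ≤ 1 / 8)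
    (hT : ∀ j, j < K - n → ∀ (y : Site (F.P K) (j + 1)) (i : Idx (F.P K)),
      ‖((tstairU (emlIterU j (bgUnits F K U₀)) (dbarCovIterU j (bgUnits F K U₀) (fun b => expUnit (A₁ b) * bgUnits F K U₀ b)) y i : (Matrix (Fin 2) (Fin 2) ℂ)ˣ) :
        Matrix (Fin 2) (Fin 2) ℂ) - 1‖ ≤ 1 / 8)
    (U' : GaugeField (F.P K) 0 (Matrix.specialUnitaryGroup (Fin 2) ℂ))
    (ξ : PBond (F.P K) 0 → Matrix (Fin 2) (Fin 2) ℂ) (hξ : ∀ b, star (ξ b) = -ξ b ∧ (ξ b).trace = 0)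
    (β : PBond (F.P K) 0 → Matrix (Fin 2) (Fin 2) ℂ) (N : Site (F.P K) 0 → Matrix (Fin 2) (Fin 2) ℂ)
    (hβ : fderiv ℂ (logChartTwS F n K h U₀) A₁ β = 0)
    (hsplit : ∀ b : PBond (F.P K) 0, ξ b = gSer ℂ (ad ℂ (-A₁ b)) (β b)
      + (N b.src - ((bgUnits F K U' b : (Matrix (Fin 2) (Fin 2) ℂ)ˣ) : Matrix (Fin 2) (Fin 2) ℂ) * N b.tgt * (((bgUnits F K U' b)⁻¹ : (Matrix (Fin 2) (Fin 2) ℂ)ˣ) : Matrix (Fin 2) (Fin 2) ℂ))) :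
    ∃ β' : PBond (F.P K) 0 → Matrix (Fin 2) (Fin 2) ℂ, (∀ b, star (β' b) = -β' b ∧ (β' b).trace = 0) ∧ fderiv ℂ (logChartTwS F n K h U₀) A₁ β' = 0 ∧
      ∃ N' : Site (F.P K) 0 → Matrix (Fin 2) (Fin 2) ℂ, (∀ x, (N' x).IsHermitian ∧ (N' x).trace = 0) ∧
        ∀ b : PBond (F.P K) 0, ξ b = gSer ℂ (ad ℂ (-A₁ b)) (β' b)
          + (Complex.I • N' b.src - ((U' b : Matrix.specialUnitaryGroup (Fin 2) ℂ) : Matrix (Fin 2) (Fin 2) ℂ) * (Complex.I • N' b.tgt)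
              * star ((U' b : Matrix.specialUnitaryGroup (Fin 2) ℂ) : Matrix (Fin 2) (Fin 2) ℂ)) := by
  -- abbreviations
  set D := fderiv ℂ (logChartTwS F n K h U₀) A₁ with hD
  set s : PBond (F.P K) 0 → ℂ := fun b => (2 : ℂ)⁻¹ * (β b).trace with hs
  set hN : Site (F.P K) 0 → ℂ := fun x => (2 : ℂ)⁻¹ * (N x).trace with hhN
  set βt : PBond (F.P K) 0 → Matrix (Fin 2) (Fin 2) ℂ := fun b => β b - s b • (1 : Matrix (Fin 2) (Fin 2) ℂ) with hβt
  set Nt : Site (F.P K) 0 → Matrix (Fin 2) (Fin 2) ℂ := fun x => N x - hN x • (1 : Matrix (Fin 2) (Fin 2) ℂ) with hNt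
  set β' : PBond (F.P K) 0 → Matrix (Fin 2) (Fin 2) ℂ := fun b => (2 : ℂ)⁻¹ • (βt b - star (βt b)) with hβ'
  set bb : PBond (F.P K) 0 → Matrix (Fin 2) (Fin 2) ℂ := fun b => (-(Complex.I * (2 : ℂ)⁻¹)) • (βt b + star (βt b)) with hbb
  set Ns : Site (F.P K) 0 → Matrix (Fin 2) (Fin 2) ℂ := fun x => (2 : ℂ)⁻¹ • (Nt x - star (Nt x)) with hNs
  -- scalar bookkeeping
  have h2 : star ((2 : ℂ)⁻¹) = (2 : ℂ)⁻¹ := by rw [Complex.star_def, map_inv₀, map_ofNat]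
  have htr1 : Matrix.trace (1 : Matrix (Fin 2) (Fin 2) ℂ) = 2 := by rw [Matrix.trace_one, Fintype.card_fin]; norm_num
  have htrstar : ∀ X : Matrix (Fin 2) (Fin 2) ℂ, (star X).trace = star X.trace := fun X => by
    rw [Matrix.star_eq_conjTranspose, Matrix.trace_conjTranspose]
  have hβt_tr : ∀ b, (βt b).trace = 0 := fun b => by
    simp only [hβt, hs, Matrix.trace_sub, Matrix.trace_smul, htr1, smul_eq_mul]; ring
  have hNt_tr : ∀ x, (Nt x).trace = 0 := fun x => by
    simp only [hNt, hhN, Matrix.trace_sub, Matrix.trace_smul, htr1, smul_eq_mul]; ring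
  -- the skew parts are `𝔰𝔲(2)`-valued
  have hskew : ∀ X : Matrix (Fin 2) (Fin 2) ℂ, X.trace = 0 →
      star ((2 : ℂ)⁻¹ • (X - star X)) = -((2 : ℂ)⁻¹ • (X - star X)) ∧ ((2 : ℂ)⁻¹ • (X - star X)).trace = 0 := fun X hX => by
    refine ⟨?_, ?_⟩
    · rw [star_smul, h2, star_sub, star_star, ← smul_neg, neg_sub]
    · rw [Matrix.trace_smul, Matrix.trace_sub, htrstar, hX, star_zero, sub_zero, smul_zero]
  have hβ'R : ∀ b, star (β' b) = -β' b ∧ (β' b).trace = 0 := fun b => hskew (βt b) (hβt_tr b)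
  have hNsR : ∀ x, star (Ns x) = -Ns x ∧ (Ns x).trace = 0 := fun x => hskew (Nt x) (hNt_tr x)
  have hbbR : ∀ b, star (bb b) = -bb b ∧ (bb b).trace = 0 := fun b => by
    refine ⟨?_, ?_⟩
    · have hc : star (-(Complex.I * (2 : ℂ)⁻¹)) = -(-(Complex.I * (2 : ℂ)⁻¹)) := by
        rw [star_neg, star_mul', h2, Complex.star_def, Complex.conj_I, neg_mul]
      show star ((-(Complex.I * (2 : ℂ)⁻¹)) • (βt b + star (βt b))) = -((-(Complex.I * (2 : ℂ)⁻¹)) • (βt b + star (βt b)))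
      rw [star_smul, star_add, star_star, add_comm (star (βt b)) (βt b), hc, neg_smul]
    · show ((-(Complex.I * (2 : ℂ)⁻¹)) • (βt b + star (βt b))).trace = 0
      rw [Matrix.trace_smul, Matrix.trace_add, htrstar, hβt_tr, star_zero, add_zero, smul_zero]
  -- the decomposition `β = β′ + i·bb + s·1`
  have hβdec : β = β' + Complex.I • bb + fun b => s b • (1 : Matrix (Fin 2) (Fin 2) ℂ) := by
    funext b
    simp only [Pi.add_apply, Pi.smul_apply, hβ', hbb, hβt, smul_smul]
    have hI : Complex.I * -(Complex.I * (2 : ℂ)⁻¹) = (2 : ℂ)⁻¹ := by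
      rw [mul_neg, ← mul_assoc, Complex.I_mul_I, neg_mul, neg_neg, one_mul]
    rw [hI]
    module
  -- (i) `D β′ = 0`
  have hDβ' : D β' = 0 := by
    have hsum : D β' + Complex.I • D bb + D (fun b => s b • (1 : Matrix (Fin 2) (Fin 2) ℂ)) = 0 := by
      rw [← map_smul, ← map_add, ← map_add, ← hβdec]; exact hβ
    funext c
    have hc : D β' c + Complex.I • D bb c + D (fun b => s b • (1 : Matrix (Fin 2) (Fin 2) ℂ)) c = 0 := by
      have := congrArg (fun Y : PBond (F.P n) 0 → Matrix (Fin 2) (Fin 2) ℂ => Y c) hsum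
      simpa only [Pi.add_apply, Pi.smul_apply, Pi.zero_apply] using this
    rw [fderiv_logChartTwS_central F h hε₀ he hWe hWε U₀ hreg hA₁ hWl hT s c] at hc
    exact (eq_zero_of_su2_add_I_smul_su2_add_smul_one (fderiv_logChartTwS_su2 F h hε₀ he hWe hWε U₀ hreg hA₁ hA₁R β' hβ'R c)
      (fderiv_logChartTwS_su2 F h hε₀ he hWe hWε U₀ hreg hA₁ hA₁R bb hbbR c) hc).1
  refine ⟨β', hβ'R, hDβ', fun x => (-Complex.I) • Ns x, fun x => ⟨?_, ?_⟩, fun b => ?_⟩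
  · -- Hermitian
    show ((-Complex.I) • Ns x)ᴴ = (-Complex.I) • Ns x
    rw [Matrix.conjTranspose_smul, ← Matrix.star_eq_conjTranspose, (hNsR x).1, star_neg, Complex.star_def, Complex.conj_I, neg_neg, smul_neg, neg_smul]
  · show ((-Complex.I) • Ns x).trace = 0
    rw [Matrix.trace_smul, (hNsR x).2, smul_zero]
  · -- (ii) the split at the bond `b`
    set U : Matrix (Fin 2) (Fin 2) ℂ := ((U' b : Matrix.specialUnitaryGroup (Fin 2) ℂ) : Matrix (Fin 2) (Fin 2) ℂ) with hU
    have hUU : U * star U = 1 := Matrix.mem_unitaryGroup_iff.1 (U' b).2.1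
    have hU'U : star U * U = 1 := Matrix.mem_unitaryGroup_iff'.1 (U' b).2.1
    obtain ⟨hcoe, hinv⟩ := coe_bgUnits_apply F U' b
    set M : Matrix (Fin 2) (Fin 2) ℂ →L[ℂ] Matrix (Fin 2) (Fin 2) ℂ := gSer ℂ (ad ℂ (-A₁ b)) with hM
    have hY : star (-A₁ b) = -(-A₁ b) := by rw [star_neg, (hA₁R b).1]
    have hII : ∀ X : Matrix (Fin 2) (Fin 2) ℂ, Complex.I • ((-Complex.I) • X) = X := fun X => by
      rw [smul_smul, mul_neg, Complex.I_mul_I, neg_neg, one_smul]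
    rw [hII, hII]
    -- the given split, read with `U`, `star U`
    have h0 : ξ b = M (β b) + (N b.src - U * N b.tgt * star U) := by rw [hsplit b, hcoe, hinv]
    -- step T: the scalar parts drop out
    have hβb : β b = βt b + s b • (1 : Matrix (Fin 2) (Fin 2) ℂ) := by simp only [hβt, sub_add_cancel]
    have hNx : ∀ x, N x = Nt x + hN x • (1 : Matrix (Fin 2) (Fin 2) ℂ) := fun x => by simp only [hNt, sub_add_cancel]
    have h1 : ξ b = M (βt b) + (Nt b.src - U * Nt b.tgt * star U) + (s b + hN b.src - hN b.tgt) • (1 : Matrix (Fin 2) (Fin 2) ℂ) := by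
      rw [h0, hβb, map_add, hM, gSer_ad_apply_smul_one, ← hM, hNx b.src, hNx b.tgt, mul_add, add_mul, Matrix.mul_smul, Matrix.smul_mul, mul_one, hUU,
        sub_smul, add_smul]
      abel
    have hσ : s b + hN b.src - hN b.tgt = 0 := by
      have ht := congrArg Matrix.trace h1
      rw [(hξ b).2, Matrix.trace_add, Matrix.trace_add, Matrix.trace_sub, hM, trace_gSer_ad_apply_eq, hβt_tr, Matrix.trace_smul, htr1,
        Matrix.trace_mul_comm, ← mul_assoc, hU'U, one_mul, hNt_tr, hNt_tr, sub_zero, zero_add, zero_add, smul_eq_mul] at ht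
      have : (s b + hN b.src - hN b.tgt) * 2 = 0 := ht.symm
      simpa using this
    rw [hσ, zero_smul, add_zero] at h1
    -- step S: the skew parts
    have hsM : star (M (βt b)) = M (star (βt b)) := by rw [hM]; exact star_gSer_ad_apply hY (βt b)
    have hsG : star (Nt b.src - U * Nt b.tgt * star U) = star (Nt b.src) - U * star (Nt b.tgt) * star U := by
      rw [star_sub, star_mul, star_mul, star_star, ← mul_assoc]
    have h1s : star (ξ b) = M (star (βt b)) + (star (Nt b.src) - U * star (Nt b.tgt) * star U) := by
      rw [h1, star_add, hsM, hsG]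
    have hξ2 : ξ b = (2 : ℂ)⁻¹ • (ξ b - star (ξ b)) := by
      rw [(hξ b).1, sub_neg_eq_add, ← two_smul ℂ (ξ b), smul_smul, inv_mul_cancel₀ (two_ne_zero), one_smul]
    rw [hξ2]
    nth_rewrite 1 [h1]
    rw [h1s]
    simp only [hβ', hNs, map_smul, map_sub, Matrix.mul_smul, Matrix.smul_mul, mul_sub, sub_mul]
    module

end Main

end Summit.QuantumFields.YangMills.Theorems.Prop7TwistedSliceGaugeOntoSU2

end
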